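import Summits.NavierStokesRegularity.FluidComputer.BlockVarCascade
import Summits.NavierStokesRegularity.FluidComputer.BlockReachViscous

/-!
# Block line — the residue in RELATIVE form: relative certificates, assembly, `¬ (Clay A)`, and
# the viscous no-go of `BlockReachViscous.lean` turned into a clock constraint

HONEST FRAMING: low prior, high value-of-information experiment on Tao's machine paradigm; NOT a
claim that NS blows up. The structure `RelOpenReachBound` below is this lane's RESIDUE (the
unproved, presumably FALSE, Navier–Stokes-side claim about the two-wavelet design) re-typed once
more; nothing here is evidence about Navier–Stokes.

WHY. `BlockReachViscous.lean` / `BlockReachProbe.lean` / `BlockReachVoid.lean` /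
`BlockPairCeiling.lean` showed that the residue of `BlockQuadReach.lean` — readout right-derivative
within an ABSOLUTE `ε` of the design field on an amplitude-UNBOUNDED working region — is refuted
by the true equation for every `ε` and every design field: viscosity alone moves a clean loaded
state of amplitude `A` at speed `Λ_n A` (unbounded in `A`). Every such witness is PROPORTIONAL TO
THE AMPLITUDE. This file therefore re-types both halves of the reach layer with a RELATIVE
tolerance `ε (1 + ‖z‖)` (`relMod ε`), using the variable-tolerance circuit `VarReachCircuit` of
`BlockVarCircuit.lean` / `BlockVarCascade.lean`.

WHAT IS PROVED ([folklore] throughout). §1 `RelReachCertificate F U ω τc Ain Aout`: a reach–avoid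
certificate robust to right-derivative defects of VARIABLE size `ω (x σ)` (generic phase space); a
relative certificate is STRONGER than an absolute one (`toReachCertificate`). §2 the relative
residue `RelOpenReachBound 𝒟 P F U ε τc` (junk ceiling, leak rate, clock, and the two guarded
instantaneous inequalities with readout defect `≤ ε (1 + ‖read‖)`); the absolute residue implies
it (`OpenReachBound.toRel`). §3 ASSEMBLY `toVarReachCircuit` with the open-window statics of
`BlockOpenWindow.lean` and ANY relative certificate from `AinO` to `AoutO`; `¬ NavierStokesRegularity`
(`ns_blowup_of_relOpenReachBound`); liveness and the cascade theorem from BOUNDED tubes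
(`controlAt_of_bounded`, `energy_reaches_all_scales_of_relOpenReachBound`). §4 THE VISCOUS TEST,
FLIPPED: where `BlockReachViscous.false_of_ray` refutes the absolute residue outright, the same
clean-ray computation (`hasDerivWithinAt_read_fst_clean`) shows the relative residue forces the
CLOCK CONSTRAINT `unit n · Λ_n ≤ ε` at every generation (`unit_mul_viscRate_le`; for the quadratic
gate on the loaded region `unit_mul_viscRate_le_quad`, hence `unit n ≤ ε / (4π²)`): a satisfiable
design inequality ("viscous decay per tick below the relative tolerance"), not `False`. Whether a
relative certificate for the quadratic gate exists (homogeneity `z = s w`) is the next design item;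
whether `RelOpenReachBound` holds for two wavelets is the residue proper (presumably not: junk
production `B(ψ_n, ψ_n) ∉ span ψ_{n+1}`).
-/

noncomputable section

open MeasureTheory Set Filter Topology Metric
open scoped ENNReal NNReal SchwartzMap

namespace Summit.NavierStokesRegularity.FluidComputer

open Literature.Analysis.FluidPDE Literature.Analysis.FluidPDE.Tao2016
open Literature.Analysis.FluidPDE.FluidComputer
open Literature.Analysis.FunctionSpaces (eFourierSobolevNorm)
open Summit.NavierStokesRegularity.NavierStokesRegularity.Theorems.FluidComputer

/-! ### §1. Relative reach–avoid certificates (design level, generic phase space) -/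

section Generic

variable {O : Type*} [NormedAddCommGroup O] [NormedSpace ℝ O]

/-- **A reach–avoid certificate robust to right-derivative defects of variable size `ω`** for the
field `F` on the working region `U`, cycle time `τc`, from `Ain` to `Aout`: the fields `Tube`,
`Tube_closed`, `Tube_zero`, `Tube_sub`, `cert` of `VarReachCircuit` at one generation
(`ReachCertificate` with `‖W - F (x σ)‖ ≤ ω (x σ)` for `≤ ε`). [folklore] -/
structure RelReachCertificate (F : O → O) (U : Set O) (ω : O → ℝ) (τc : ℝ) (Ain Aout : Set O) where
  /-- the readouts certified reachable at rescaled time `σ` from `p` -/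
  Tube : O → ℝ → Set O
  Tube_closed : ∀ p ∈ Ain, IsClosed {z : ℝ × O | z.1 ∈ Icc 0 τc ∧ z.2 ∈ Tube p z.1}
  Tube_zero : ∀ p ∈ Ain, p ∈ Tube p 0
  Tube_sub : ∀ p ∈ Ain, ∀ σ ∈ Icc 0 τc, Tube p σ ⊆ U
  cert : ∀ p ∈ Ain, ∀ (σT : ℝ) (x : ℝ → O), 0 ≤ σT → σT ≤ τc → x 0 = p →
    ContinuousOn x (Icc 0 σT) → (∀ σ ∈ Ico 0 σT, x σ ∈ U) →
      (∀ σ ∈ Ico 0 σT, ∃ W : O, HasDerivWithinAt x W (Ici σ) σ ∧ ‖W - F (x σ)‖ ≤ ω (x σ)) →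
        x σT ∈ Tube p σT ∧ (σT = τc → ∃ σ ∈ Icc 0 τc, x σ ∈ Aout)

/-- The RELATIVE defect modulus `ε (1 + ‖z‖)`. [folklore] -/
def relMod (ε : ℝ) (z : O) : ℝ := ε * (1 + ‖z‖)

omit [NormedSpace ℝ O] in
/-- `ε ≤ ε (1 + ‖z‖)` for `ε ≥ 0`. [folklore] -/
theorem le_relMod {ε : ℝ} (hε : 0 ≤ ε) (z : O) : ε ≤ relMod ε z := by
  unfold relMod; nlinarith [norm_nonneg z]

/-- **A relative certificate is an absolute one** (it tolerates larger defects). [folklore] -/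
def RelReachCertificate.toReachCertificate {F : O → O} {U : Set O} {ε τc : ℝ} {Ain Aout : Set O}
    (c : RelReachCertificate F U (relMod ε) τc Ain Aout) (hε : 0 ≤ ε) :
    ReachCertificate F U ε τc Ain Aout where
  Tube := c.Tube
  Tube_closed := c.Tube_closed
  Tube_zero := c.Tube_zero
  Tube_sub := c.Tube_sub
  cert := fun p hp σT x h0 hτ hx hc hU hW => c.cert p hp σT x h0 hτ hx hc hU fun σ hσ =>
    (hW σ hσ).imp fun _ h => ⟨h.1, h.2.trans (le_relMod hε _)⟩

end Generic

namespace BlockDesign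

variable (𝒟 : CascadeWaveletData 1 1) {S : CascadeSpecs} (P : Params S)

/-! ### §2. The residue in relative form -/

/-- **THE RESIDUE of an open block design with design field `F`, working region `U`, relative
tolerance `ε` and cycle time `τc`, in LOCAL GUARDED RELATIVE form** (presumed FALSE for the
two-wavelet design; typed, never claimed): a junk ceiling `jbar > jrun`, a leak rate `γ` with
`jin + γ τc ≤ jrun`, a clock, and two instantaneous inequalities about every `H¹⁰_df`-mild
Navier–Stokes trajectory, GUARDED by `readout ∈ U` and `junk < jbar √E_n` — (i) READOUT DEFECT:
the rescaled right derivative of the readout is within `ε (1 + ‖readout‖)` of `F`; (ii) JUNK RATE: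
lower right Dini derivative of the junk at most `γ √E_n` per rescaled unit time. [folklore] -/
structure RelOpenReachBound (F : ℝ × ℝ → ℝ × ℝ) (U : Set (ℝ × ℝ)) (ε τc : ℝ) where
  /-- the junk CEILING of the working region (relative, in units of `√E_n`), above running junk -/
  jbar : ℝ
  jrun_lt_jbar : P.jrun < jbar
  /-- LEAK RATE per rescaled unit time, within the budget `jin + γ τc ≤ jrun` -/
  γ : ℝ
  γ_nonneg : 0 ≤ γ
  jrun_ge : P.jin + γ * τc ≤ P.jrun
  /-- CLOCK: physical time per unit rescaled time at generation `n`; one cycle fits in `Tmax n` -/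
  unit : ℕ → ℝ
  unit_pos : ∀ n, 0 < unit n
  clock : ∀ n, unit n * τc ≤ S.Tmax n
  /-- DYNAMICS (instantaneous, guarded): RELATIVE READOUT DEFECT -/
  defect : ∀ (n : ℕ) (a : L2C) (S' : ℝ) (u : ℝ → L2C), IsMildSolutionFor eulerForm a (Ico 0 S') u →
    ∀ t : ℝ, 0 ≤ t → t < S' → read 𝒟 S n (u t) ∈ U →
      junk 𝒟 P n (u t) < ENNReal.ofReal (jbar * Real.sqrt (S.Emin n)) →
        ∃ W : ℝ × ℝ, HasDerivWithinAt (fun t' => read 𝒟 S n (u t')) W (Ici t) t ∧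
          ‖unit n • W - F (read 𝒟 S n (u t))‖ ≤ relMod ε (read 𝒟 S n (u t))
  /-- DYNAMICS (instantaneous, guarded): JUNK RATE -/
  junk_rate : ∀ (n : ℕ) (a : L2C) (S' : ℝ) (u : ℝ → L2C),
    IsMildSolutionFor eulerForm a (Ico 0 S') u →
      ∀ t : ℝ, 0 ≤ t → t < S' → read 𝒟 S n (u t) ∈ U →
        junk 𝒟 P n (u t) < ENNReal.ofReal (jbar * Real.sqrt (S.Emin n)) →
          ∀ ρ : ℝ, γ < ρ → ∃ᶠ t' in 𝓝[>] t,
            junk 𝒟 P n (u t') ≤ junk 𝒟 P n (u t) +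
              ENNReal.ofReal (ρ * Real.sqrt (S.Emin n) * ((t' - t) / unit n))

variable {𝒟 P}

/-- **The absolute residue implies the relative one** (`τc = 1`, `γ = jrun - jin`). [folklore] -/
def OpenReachBound.toRel {F : ℝ × ℝ → ℝ × ℝ} {U : Set (ℝ × ℝ)} {ε : ℝ} (hε : 0 ≤ ε)
    (H : OpenReachBound 𝒟 P F U ε) : RelOpenReachBound 𝒟 P F U ε 1 where
  jbar := H.jbar
  jrun_lt_jbar := H.jrun_lt_jbar
  γ := P.jrun - P.jin
  γ_nonneg := sub_nonneg.2 P.jin_le_jrun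
  jrun_ge := by linarith
  unit := H.unit
  unit_pos := H.unit_pos
  clock := fun n => by rw [mul_one]; exact H.clock n
  defect := fun n a S' u hu t ht hS hU hj => (H.defect n a S' u hu t ht hS hU hj).imp
    fun _ h => ⟨h.1, h.2.trans (le_relMod hε _)⟩
  junk_rate := H.junk_rate

/-! ### §3. Assembly: the relative residue + a relative certificate = a `VarReachCircuit` -/

/-- **The open block design assembled in the VARIABLE-TOLERANCE reach layer**: the statics of
`BlockOpenWindow.lean`, the relative residue, and ANY relative reach–avoid certificate for `F` on
the open working region `U` with modulus `relMod ε`, cycle time `τc ≥ 0`, from `AinO P` to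
`AoutO P`, form a `VarReachCircuit` (`s ≤ 10`; all data level-free). [folklore] -/
def RelOpenReachBound.toVarReachCircuit {F : ℝ × ℝ → ℝ × ℝ} {U : Set (ℝ × ℝ)} {ε τc : ℝ}
    (H : RelOpenReachBound 𝒟 P F U ε τc) (hs : P.s ≤ 10) (hU : IsOpen U) (hτ : 0 ≤ τc)
    (c : RelReachCertificate F U (relMod ε) τc (AinO P) (AoutO P)) :
    VarReachCircuit S (ℝ × ℝ) P.s where
  read := read 𝒟 S
  recon := recon 𝒟 S
  junk := junk 𝒟 P
  Λ := (Real.sqrt S.eta)⁻¹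
  Λ_pos := inv_pos.2 (Real.sqrt_pos.2 S.eta_pos)
  read_lip := fun n v w => read_lip n v w
  junk_perturb := fun n v w => junk_perturb n v w
  s_le_ten := hs
  read_recon := fun n p => read_recon n p
  junk_recon := fun n p => junk_recon n p
  Ain := fun _ => AinO P
  Acore := fun _ => AcoreO P
  Aout := fun _ => AoutO P
  δ := P.δ
  δ_pos := P.δ_pos
  core_thick := fun _ p hp => core_thickO p hp
  jcore := P.jcore
  jin := P.jin
  jrun := P.jrun
  jbar := H.jbar
  jcore_nonneg := P.jcore_nonneg
  jcore_lt := P.jcore_lt_jin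
  jrun_lt_jbar := H.jrun_lt_jbar
  handoff := fun n v hv hj => handoffO n v hv hj
  floor_cert := fun n v hv _ => floor_certO n v hv
  F := fun _ => F
  U := fun _ => U
  U_open := fun _ => hU
  τc := τc
  τc_nonneg := hτ
  ω := fun _ => relMod ε
  Tube := fun _ => c.Tube
  Tube_closed := fun _ => c.Tube_closed
  Tube_zero := fun _ => c.Tube_zero
  Tube_sub := fun _ => c.Tube_sub
  cert := fun _ => c.cert
  γ := H.γ
  γ_nonneg := H.γ_nonneg
  jrun_ge := H.jrun_ge
  unit := H.unit
  unit_pos := H.unit_pos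
  clock := H.clock
  defect := H.defect
  junk_rate := H.junk_rate
  u₀ := seed 𝒟 P
  divFree := seed_divFree 𝒟 P
  memH10df := seed_memH10df 𝒟 P
  seed_read := seed_readO 𝒟 P
  seed_junk := seed_junk 𝒟 P

/-- **THE RELATIVE RESIDUE PLUS A RELATIVE CERTIFICATE REFUTES CLAY (A)** (`s ≤ 10`, `α > 0`,
`η > 1/4`). HONEST FRAMING: the residue is presumed FALSE for the two-wavelet design, and no
relative certificate for its gate is in the tree yet; NOT a claim that NS blows up. [folklore] -/
theorem ns_blowup_of_relOpenReachBound {F : ℝ × ℝ → ℝ × ℝ} {U : Set (ℝ × ℝ)} {ε τc : ℝ}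
    (H : RelOpenReachBound 𝒟 P F U ε τc) (hs : P.s ≤ 10) (hU : IsOpen U) (hτ : 0 ≤ τc)
    (c : RelReachCertificate F U (relMod ε) τc (AinO P) (AoutO P)) (hα : 0 < S.alpha)
    (hη : 1 / 4 < S.eta) : ¬ NavierStokesRegularity :=
  (H.toVarReachCircuit hs hU hτ c).ns_blowup hα hη

/-- **Per-input control from BOUNDED tubes** (`s = 10`, `μ > 0`): if every certified tube
`Tube p σ`, `σ ≤ τc`, from an input readout `p` is bounded, the assembled design has per-input
`H¹⁰` control (`h10Bound_of_read_le`). [folklore] -/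
theorem controlAt_of_bounded {F : ℝ × ℝ → ℝ × ℝ} {U : Set (ℝ × ℝ)} {ε τc : ℝ}
    (H : RelOpenReachBound 𝒟 P F U ε τc) (hs : P.s = 10) (hμ : 0 < P.μ) (hU : IsOpen U)
    (hτ : 0 ≤ τc) (c : RelReachCertificate F U (relMod ε) τc (AinO P) (AoutO P))
    (hbd : ∀ p ∈ AinO P, ∃ R' : ℝ, 0 ≤ R' ∧ ∀ σ ∈ Icc 0 τc, ∀ z ∈ c.Tube p σ, ‖z‖ ≤ R') :
    (H.toVarReachCircuit hs.le hU hτ c).ControlAt := by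
  intro n p hp
  obtain ⟨R', hR', hR⟩ := hbd p hp
  obtain ⟨M, hM⟩ := h10Bound_of_read_le (𝒟 := 𝒟) (P := P) hs.ge hμ n hR'
  refine ⟨M, fun v _ htube hj => hM v ?_ hj⟩
  obtain ⟨σ, hσ, hz⟩ := htube
  exact hR σ hσ _ hz

/-- **THE CASCADE THEOREM for the relative residue with a bounded relative certificate** (`s = 10`,
`μ > 0`, `α > 0`, `η > 1/4`): every generation's floor energy appears at frequency `≥ λ_n` at
clocked instants along the seed's maximal mild trajectory, whose `H¹⁰` norm is unbounded.
[folklore] -/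
theorem energy_reaches_all_scales_of_relOpenReachBound {F : ℝ × ℝ → ℝ × ℝ} {U : Set (ℝ × ℝ)}
    {ε τc : ℝ} (H : RelOpenReachBound 𝒟 P F U ε τc) (hs : P.s = 10) (hμ : 0 < P.μ)
    (hU : IsOpen U) (hτ : 0 ≤ τc) (c : RelReachCertificate F U (relMod ε) τc (AinO P) (AoutO P))
    (hbd : ∀ p ∈ AinO P, ∃ R' : ℝ, 0 ≤ R' ∧ ∀ σ ∈ Icc 0 τc, ∀ z ∈ c.Tube p σ, ‖z‖ ≤ R')
    (hα : 0 < S.alpha) (hη : 1 / 4 < S.eta) :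
    ∃ Sm : ℝ, 0 < Sm ∧ Sm ≤ S.Tstar ∧ ∃ U' : ℝ → L2C,
      IsMildSolutionFor eulerForm (schwartzL2 (seed 𝒟 P)) (Ico 0 Sm) U' ∧
      (∀ C : ℝ, ∃ s ∈ Ico 0 Sm, ENNReal.ofReal C < eFourierSobolevNorm 10 (U' s)) ∧
      ∃ t : ℕ → ℝ, t 0 = 0 ∧ Monotone t ∧
        ∀ n, t n < Sm ∧ t n ≤ ∑ k ∈ Finset.range n, S.Tmax k ∧
          ENNReal.ofReal (S.Emin n) ≤ highFreqEnergy (S.lam n) (U' (t n)) :=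
  (H.toVarReachCircuit hs.le hU hτ c).energy_reaches_all_scales_of_controlAt hα hη
    (controlAt_of_bounded H hs hμ hU hτ c hbd)

/-! ### §4. The viscous test, flipped: the relative residue constrains the clock -/

/-- **THE CLOCK CONSTRAINT.** If the working region contains the clean input ray
`{(A, 0) : A ≥ A₀}` and the design field has vanishing input component on it, the relative
residue forces `unit n · Λ_n ≤ ε` (`Λ_n = viscRate 𝒟 n`): along the true trajectory from the clean
state `A√E_n ψ_n` the input readout has right derivative `-Λ_n A` (`hasDerivWithinAt_read_fst_clean`),
so `unit n · Λ_n · A ≤ ε (1 + A)` for every `A ≥ max A₀ 0`; let `A → ∞`. Compare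
`OpenReachBound.false_of_ray`: the absolute residue gives `False` here. [folklore] -/
theorem RelOpenReachBound.unit_mul_viscRate_le {F : ℝ × ℝ → ℝ × ℝ} {U : Set (ℝ × ℝ)} {ε τc : ℝ}
    (H : RelOpenReachBound 𝒟 P F U ε τc) (n : ℕ) {A₀ : ℝ}
    (hU : ∀ A : ℝ, A₀ ≤ A → ((A, 0) : ℝ × ℝ) ∈ U)
    (hF : ∀ A : ℝ, A₀ ≤ A → (F (A, 0)).1 = 0) : H.unit n * viscRate 𝒟 n ≤ ε := by
  have hΛ := viscRate_pos 𝒟 n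
  have hun := H.unit_pos n
  by_contra hlt
  push Not at hlt
  set d : ℝ := H.unit n * viscRate 𝒟 n - ε with hd
  have hdpos : 0 < d := by simp only [hd]; linarith
  -- an amplitude beyond `A₀`, `0`, and `ε / d`
  set A : ℝ := max (max A₀ 0) (ε / d + 1) with hA
  have hA₀ : A₀ ≤ A := (le_max_left _ _).trans (le_max_left _ _)
  have hA0 : 0 ≤ A := (le_max_right _ _).trans (le_max_left _ _)
  have hAd : ε < d * A := by
    have h1 : ε / d + 1 ≤ A := le_max_right _ _
    have h2 : ε / d * d = ε := div_mul_cancel₀ _ hdpos.ne'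
    nlinarith
  -- the true trajectory from the clean loaded design state `A√E_n ψ_n`
  have ha : MemH10df (recon 𝒟 S n (A, 0)) := memH10df_recon 𝒟 S n _
  obtain ⟨T, hT, u, hu⟩ := h10MildTheory_holds.localExistence _ ha
  have hu0 : u 0 = recon 𝒟 S n (A, 0) := initial_eq hu ⟨le_rfl, hT⟩ ha
  have hread : read 𝒟 S n (u 0) = (A, 0) := by rw [hu0, read_recon]
  have hjunk : junk 𝒟 P n (u 0) < ENNReal.ofReal (H.jbar * Real.sqrt (S.Emin n)) := by
    rw [hu0, junk_recon]
    exact ENNReal.ofReal_pos.2 (mul_pos (P.jrun_pos.trans H.jrun_lt_jbar) (sqrt_Emin_pos S n))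
  obtain ⟨W, hW, hWε⟩ := H.defect n _ T u hu 0 le_rfl hT (hread ▸ hU A hA₀) hjunk
  -- two right derivatives of the input readout at `t = 0`: the claimed `W.1` and the true `-Λ_n A`
  have hW1 : HasDerivWithinAt (fun t => (read 𝒟 S n (u t)).1) W.1 (Ici 0) 0 :=
    (ContinuousLinearMap.fst ℝ ℝ ℝ).hasFDerivAt.comp_hasDerivWithinAt 0 hW
  have htrue := hasDerivWithinAt_read_fst_clean 𝒟 S n A hT hu
  have hEq : W.1 = -(viscRate 𝒟 n * A) :=
    (uniqueDiffOn_Ici (0 : ℝ) 0 (Set.mem_Ici.2 le_rfl)).eq_deriv _ hW1 htrue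
  -- the relative defect inequality, first component; `‖(A, 0)‖ = A`
  rw [hread] at hWε
  have hnorm : ‖((A, 0) : ℝ × ℝ)‖ = A := by
    simp only [Prod.norm_def, Real.norm_eq_abs, abs_zero, abs_of_nonneg hA0, max_eq_left hA0]
  have h1 : |H.unit n * W.1 - (F (A, 0)).1| ≤ ε * (1 + A) := by
    have h := (norm_fst_le (H.unit n • W - F (A, 0))).trans hWε
    simpa [Real.norm_eq_abs, relMod, hnorm] using h
  rw [hEq, hF A hA₀, sub_zero, mul_neg, abs_neg,
    abs_of_nonneg (mul_nonneg hun.le (mul_nonneg hΛ.le hA0))] at h1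
  have h2 : d * A ≤ ε := by
    have : H.unit n * viscRate 𝒟 n * A ≤ ε + ε * A := by
      linarith [mul_assoc (H.unit n) (viscRate 𝒟 n) A]
    simp only [hd]; nlinarith
  linarith

/-- **THE CLOCK CONSTRAINT for the quadratic gate on the loaded region** — the setting in which
`BlockReachViscous.not_openReachBound_quad` refutes the absolute residue: the relative residue
`RelOpenReachBound 𝒟 P (quadVF k η) (loadedRegion η) ε τc` forces `unit n · Λ_n ≤ ε` for every
generation `n` (`mem_loadedRegion_ray`, `quadVF_fst_ray`). [folklore] -/
theorem RelOpenReachBound.unit_mul_viscRate_le_quad {k η ε τc : ℝ}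
    (H : RelOpenReachBound 𝒟 P (quadVF k η) (loadedRegion η) ε τc) (n : ℕ) :
    H.unit n * viscRate 𝒟 n ≤ ε :=
  H.unit_mul_viscRate_le n (A₀ := 2) (fun _ hA => mem_loadedRegion_ray η hA)
    (fun A _ => quadVF_fst_ray k η A)

/-- **Hence the physical tick is at most `ε / (4π²)` at every generation** (`Λ_n ≥ 4π²`,
`four_pi_sq_le_viscRate`); in particular the relative residue for the quadratic gate needs `ε > 0`
— the relative tolerance is where viscosity is paid for. [folklore] -/
theorem RelOpenReachBound.unit_le_quad {k η ε τc : ℝ}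
    (H : RelOpenReachBound 𝒟 P (quadVF k η) (loadedRegion η) ε τc) (n : ℕ) :
    H.unit n ≤ ε / (4 * Real.pi ^ 2) ∧ 0 < ε := by
  have h := H.unit_mul_viscRate_le_quad n
  have h4 := four_pi_sq_le_viscRate 𝒟 n
  have hun := H.unit_pos n
  have hπ : 0 < 4 * Real.pi ^ 2 := by positivity
  refine ⟨?_, ?_⟩
  · rw [le_div_iff₀ hπ]
    nlinarith
  · nlinarith

end BlockDesign

end Summit.NavierStokesRegularity.FluidComputer
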